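import Mathlib

/-!
# Crux `HilbertIntegralOverconvergentIsCongruence` (stmt-Langlands-8485), line `Sketch-ideate-r1-k1`:
# stub `stub_mvCoeffInvBound` — the inverse of an integral multivariable power series is integral

Over a nonarchimedean normed field `K`, a multivariable formal power series with constant coefficient
`1` and all coefficients of norm `≤ 1` has an inverse (Mathlib `MvPowerSeries.inv`, recursion
`MvPowerSeries.coeff_inv`) all of whose coefficients have norm `≤ 1` (well-founded induction on the
exponent `n : σ →₀ ℕ`, ultrametric finite-sum bound).  The `d`-variable analogue of
`norm_coeff_inv_le_one` (file `…StubCoeffInvBound.lean`), consumed by the `d`-free Katz–Sturm lever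
`stub_katzSturmAbstract` (integrality of the inverse of the Hasse lift).  Theorems only.
-/

set_option linter.dupNamespace false

namespace Summit.Langlands.Langlands.Theorems.HilbertIntegralOverconvergentIsCongruence

/-- **Stub `stub_mvCoeffInvBound`.**  `K` a nonarchimedean normed field, `σ` any index type: if
`φ : MvPowerSeries σ K` has constant coefficient `1` and all coefficients of norm `≤ 1`, then all
coefficients of `φ⁻¹` have norm `≤ 1`. [folklore] -/
theorem stub_mvCoeffInvBound {K σ : Type*} [NormedField K] [IsUltrametricDist K]
    (φ : MvPowerSeries σ K) (h0 : MvPowerSeries.constantCoeff φ = 1)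
    (hφ : ∀ n, ‖MvPowerSeries.coeff n φ‖ ≤ 1) :
    ∀ n, ‖MvPowerSeries.coeff n φ⁻¹‖ ≤ 1 := by
  classical
  intro n
  induction n using WellFoundedLT.induction with
  | ind n ih =>
    rw [MvPowerSeries.coeff_inv, h0, inv_one]
    split_ifs with hn
    · simp
    · rw [neg_one_mul, norm_neg]
      refine IsUltrametricDist.norm_sum_le_of_forall_le_of_nonneg zero_le_one fun x _ => ?_
      split_ifs with hx
      · rw [norm_mul]
        calc ‖MvPowerSeries.coeff x.1 φ‖ * ‖MvPowerSeries.coeff x.2 φ⁻¹‖ ≤ 1 * 1 :=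
              mul_le_mul (hφ _) (ih _ hx) (norm_nonneg _) zero_le_one
          _ = 1 := one_mul 1
      · simp

end Summit.Langlands.Langlands.Theorems.HilbertIntegralOverconvergentIsCongruence
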